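import Literature.NumberTheory.LFunctions.Zhang2022.Section8ProfileSjCrude
import Literature.NumberTheory.LFunctions.Zhang2022.Section8FrontEnd44ReductionRel
import HarnessLib

/-!
# Zhang (2022) §8 p. 47: the POINTWISE step of the gathering for profile data — on the good range `dr·T² ≤ P^θ` the
# product of the two inner sums `M_j(dr)·N_j(d,r)` is its main term `A_j(dr)·B_j(d,r)` up to
# `Λ⁻²·(∏_{q∣dr}(1−q⁻¹)⁻¹)²(1+|Π(d,r)|)·ERR`, `ERR` uniform in `(d,r)`

Topic `Literature/NumberTheory/LFunctions/Zhang2022` (Landau–Siegel audit tree; verdict-neutral). Y. Zhang, *Discrete mean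
estimates and the Landau–Siegel zero*, arXiv:2211.02515v1 (2022) [Zhang2022LandauSiegel] — **an unrefereed manuscript
under adjudication; nothing here asserts or denies its Theorems 1–2; no claim about Landau–Siegel zeros.** Cell
landau-siegel §D, crux K0 = stmt-Parity-20459 (row (S)), prover ls-knife-K0-p1 g2. Profile-data twin of
`Section8FrontEnd44Reduction.pointwise_I` / `Section8FrontEnd44ReductionRel.pointwise_I_rel` (Zhang's data): the two rows
`DipoleRule.psiRow_C2` (ψ-side, LEMMA A) and `DipoleRule.antiRow_C2` (anti-side, LEMMA A* with the displayed inputs `hE`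
from the fixed-modulus content of `Skeleton.Lemma84Rel` at `μ = 6` and `hB` from the absolute logarithmic mean of `ξ₀ⱼ`)
are made UNIFORM in the outer index (`Z_t ≤ θ ≤ 1`) and multiplied:

* `jetEx γ u u′ z = γu(z) + u′(z)` (the exact ψ-jet, `γ = β_jΛ`), `massEx σ ν θ u u′ z = −ū′(z) + σū(z) + ν∫_z^θ ū`
  (the exact mass rule, `σ = Λ(β_{j+1}+β_{j+2})`, `ν = Λ²β_{j+1}β_{j+2}`: `massRule_constants`);
* `psi_main_bound` — `‖M_j(t) + χ(t)Λ⁻¹L′(1,χ)·jetEx(z_t)‖ ≤ Λ⁻¹·δM₀`;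
* `anti_main_bound` — `‖N_j(d,r) − χ(t)Λ⁻¹L′(1,χ)Π(d,r)·massEx(z_t)‖ ≤ Λ⁻¹·R(d,r)·δN₀`, `R = (∏(1−q⁻¹)⁻¹)²(1+|Π|)`;
* `norm_mul_sub_mul_le_of` (algebra) and `pointwise_good` — `‖M·N − A·B‖ ≤ Λ⁻²·R·(δM₀(|L′|K₀ + δN₀) + |L′|J₀δN₀)`.

All at a FIXED modulus, with every analytic input displayed as a hypothesis; `Λ = 𝓛⁹`, `L₁ = 𝓛^{1.1}`, `τ₁ = 2L₁/Λ`
(so `e^{τ₁Λ} = T²`).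

## References
* Y. Zhang, arXiv:2211.02515v1 (2022), §8 Lemmas 8.2–8.4 and the display before (8.10), p. 47.
  [cite: Zhang2022LandauSiegel, §8 p.47]
-/

noncomputable section

open Complex Real Finset MeasureTheory Set intervalIntegral
open scoped ComplexConjugate

namespace Literature.NumberTheory.LFunctions.Zhang2022.DipoleRule

open Skeleton KnifeEdge

/-! ### The exact jet and the exact mass rule -/

/-- **The exact ψ-jet** `γu(z) + u′(z)` (`γ = β_jΛ`; `= 𝔧_j(u;z)` up to `O(α𝓛)`, `norm_jet_sub_k0jet_le`).
[cite: Zhang2022LandauSiegel, §8 Lemma 8.2] -/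
def jetEx (γ : ℂ) (u u' : ℝ → ℂ) (z : ℝ) : ℂ := γ * u z + u' z

/-- **The exact mass rule** `−ū′(z) + σū(z) + ν∫_z^θ ū` (`σ = Λ(β′+β″)`, `ν = Λ²β′β″`; `= 𝔪(bS j, bN j; ū)(z)` up to
`O(α𝓛)`, `norm_betaSum_mul_sub_le` / `norm_betaProd_mul_add_le`). [cite: Zhang2022LandauSiegel, §8 Lemma 8.4] -/
def massEx (σ ν : ℂ) (θ : ℝ) (u u' : ℝ → ℂ) (z : ℝ) : ℂ :=
  -conj (u' z) + σ * conj (u z) + ν * ∫ y in z..θ, conj (u y)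

/-- `σ_j = Λ(β_{j+1} + β_{j+2})`, `Λ = 𝓛⁹`. [cite: Zhang2022LandauSiegel, §8 Lemma 8.4; §2 (2.13)] -/
def sigmaJ (c' : ℝ) (D : ℕ) (j : ℕ) : ℂ :=
  (betaJ c' D (j + 1) + betaJ c' D (j + 2)) * ((Real.log D ^ 9 : ℝ) : ℂ)

/-- `ν_j = Λ²β_{j+1}β_{j+2}`, `Λ = 𝓛⁹`. [cite: Zhang2022LandauSiegel, §8 Lemma 8.4; §2 (2.13)] -/
def nuJ (c' : ℝ) (D : ℕ) (j : ℕ) : ℂ :=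
  betaJ c' D (j + 1) * ((Real.log D ^ 9 : ℝ) : ℂ) * (betaJ c' D (j + 2) * ((Real.log D ^ 9 : ℝ) : ℂ))

/-! ### The uniform error constants (explicit functions of the modulus and of the profile bounds) -/

/-- `J₀ = ‖β_jΛ‖B₀ + B₁` — the size of the exact ψ-jet. [cite: Zhang2022LandauSiegel, §8 Lemma 8.2] -/
def psiJ0 (c' : ℝ) (D : ℕ) (j : ℕ) (B₀ B₁ : ℝ) : ℝ := ‖betaJ c' D j * Real.log D ^ 9‖ * B₀ + B₁

/-- **`δM₀`** — the uniform ψ-side error constant of `psi_main_bound`: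
`C₈₂(0)𝓛⁻⁶(J₀ + S) + (L₁/Λ)·S·(2L₁² + L′)`, `S = ‖γ‖²B₀ + 2‖γ‖B₁ + B₂`, `γ = β_jΛ`, `L₁ = 𝓛^{1.1}`, `L′` a bound for
`‖L′(1,χ)‖`. [cite: Zhang2022LandauSiegel, §8 Lemma 8.2] -/
def deltaM0 (c' : ℝ) (D : ℕ) (j : ℕ) (B₀ B₁ B₂ L' : ℝ) : ℝ :=
  Lemma82.C82 0 / Real.log D ^ 6 *
      ((‖betaJ c' D j * Real.log D ^ 9‖ * B₀ + B₁)
        + (‖betaJ c' D j * Real.log D ^ 9‖ ^ 2 * B₀ + 2 * ‖betaJ c' D j * Real.log D ^ 9‖ * B₁ + B₂))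
    + Real.log D ^ (11 / 10 : ℝ) / Real.log D ^ 9
      * (‖betaJ c' D j * Real.log D ^ 9‖ ^ 2 * B₀ + 2 * ‖betaJ c' D j * Real.log D ^ 9‖ * B₁ + B₂)
      * (2 * (Real.log D ^ (11 / 10 : ℝ)) ^ 2 + L')

/-- **`δN₀`** — the uniform anti-side error constant of `anti_main_bound` (relative to `R(d,r)`):
`C₈₄𝓛⁻⁶(B₁ + S) + τ₁S(τ₁ΛΞ + L′(‖A₆‖ + ‖1−A₆‖ + ‖C₆‖τ₁))`, `S = B₂ + 2‖γ₆‖B₁ + ‖γ₆‖²B₀`, `γ₆ = β₆Λ`, `τ₁ = 2L₁/Λ`,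
`A₆ = β′β″/β₆²`, `C₆ = −(β′−β₆)(β″−β₆)Λ/β₆`. [cite: Zhang2022LandauSiegel, §8 Lemma 8.4] -/
def deltaN0 (c' : ℝ) (D : ℕ) (j : ℕ) (B₀ B₁ B₂ C₈₄ Ξ L' : ℝ) : ℝ :=
  C₈₄ / Real.log D ^ 6 * (B₁ + (B₂ + 2 * ‖betaMu D 6 * Real.log D ^ 9‖ * B₁ + ‖betaMu D 6 * Real.log D ^ 9‖ ^ 2 * B₀))
    + 2 * Real.log D ^ (11 / 10 : ℝ) / Real.log D ^ 9
        * (B₂ + 2 * ‖betaMu D 6 * Real.log D ^ 9‖ * B₁ + ‖betaMu D 6 * Real.log D ^ 9‖ ^ 2 * B₀)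
        * (2 * Real.log D ^ (11 / 10 : ℝ) / Real.log D ^ 9 * Real.log D ^ 9 * Ξ
            + L' *
              (‖betaJ c' D (j + 1) * betaJ c' D (j + 2) / betaMu D 6 ^ 2‖
                + ‖1 - betaJ c' D (j + 1) * betaJ c' D (j + 2) / betaMu D 6 ^ 2‖
                + ‖-((betaJ c' D (j + 1) - betaMu D 6) * (betaJ c' D (j + 2) - betaMu D 6))
                      * (Real.log D ^ 9 : ℝ) / betaMu D 6‖
                    * (2 * Real.log D ^ (11 / 10 : ℝ) / Real.log D ^ 9)))

/-- `K₀ = B₁ + ‖σ_j‖B₀ + ‖ν_j‖B₀θ` — the size of the exact mass rule. [cite: Zhang2022LandauSiegel, §8 Lemma 8.4] -/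
def antiK0 (c' : ℝ) (D : ℕ) (j : ℕ) (B₀ B₁ θ : ℝ) : ℝ := B₁ + ‖sigmaJ c' D j‖ * B₀ + ‖nuJ c' D j‖ * (B₀ * θ)

/-! ### Sizes of the exact jet and mass rule -/

/-- `‖jetEx γ u u′ z‖ ≤ ‖γ‖B₀ + B₁`. [cite: Zhang2022LandauSiegel, §8 Lemma 8.2] -/
theorem norm_jetEx_le {γ : ℂ} {u u' : ℝ → ℂ} {z B₀ B₁ : ℝ} (h0 : ‖u z‖ ≤ B₀) (h1 : ‖u' z‖ ≤ B₁) :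
    ‖jetEx γ u u' z‖ ≤ ‖γ‖ * B₀ + B₁ := by
  unfold jetEx
  calc ‖γ * u z + u' z‖ ≤ ‖γ * u z‖ + ‖u' z‖ := norm_add_le _ _
    _ ≤ ‖γ‖ * B₀ + B₁ := by rw [norm_mul]; gcongr

/-- `‖massEx σ ν θ u u′ z‖ ≤ B₁ + ‖σ‖B₀ + ‖ν‖B₀θ` for `z ∈ [0,θ]`, `‖u‖ ≤ B₀`, `‖u′‖ ≤ B₁` on `[0,θ]`, `u` continuous.
[cite: Zhang2022LandauSiegel, §8 Lemma 8.4] -/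
theorem norm_massEx_le {σ ν : ℂ} {u u' : ℝ → ℂ} {θ z B₀ B₁ : ℝ}
    (hB0 : ∀ y ∈ Icc 0 θ, ‖u y‖ ≤ B₀) (hB1 : ∀ y ∈ Icc 0 θ, ‖u' y‖ ≤ B₁) (hz : z ∈ Icc 0 θ) :
    ‖massEx σ ν θ u u' z‖ ≤ B₁ + ‖σ‖ * B₀ + ‖ν‖ * (B₀ * θ) := by
  have hB00 : 0 ≤ B₀ := (norm_nonneg _).trans (hB0 z hz)
  have hzθ : z ≤ θ := hz.2
  have hint : ‖∫ y in z..θ, conj (u y)‖ ≤ B₀ * θ := by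
    have h1 : ‖∫ y in z..θ, conj (u y)‖ ≤ B₀ * |θ - z| := by
      refine intervalIntegral.norm_integral_le_of_norm_le_const fun y hy => ?_
      rw [Set.uIoc_of_le hzθ] at hy
      rw [Complex.norm_conj]
      exact hB0 y ⟨hz.1.trans hy.1.le, hy.2⟩
    rw [abs_of_nonneg (by linarith)] at h1
    exact h1.trans (by nlinarith [hz.1])
  unfold massEx
  calc ‖-conj (u' z) + σ * conj (u z) + ν * ∫ y in z..θ, conj (u y)‖
      ≤ ‖-conj (u' z)‖ + ‖σ * conj (u z)‖ + ‖ν * ∫ y in z..θ, conj (u y)‖ := norm_add₃_le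
    _ ≤ B₁ + ‖σ‖ * B₀ + ‖ν‖ * (B₀ * θ) := by
        rw [norm_neg, Complex.norm_conj, norm_mul, Complex.norm_conj, norm_mul]
        gcongr
        · exact hB1 z hz
        · exact hB0 z hz

/-! ### Scales at a fixed modulus -/

/-- `𝓛^{2.2} = (𝓛^{1.1})²` for `𝓛 ≥ 0`. [cite: Zhang2022LandauSiegel, §6 p.12] -/
theorem rpow_22_eq_sq {ℓ : ℝ} (hℓ : 0 ≤ ℓ) : ℓ ^ (22 / 10 : ℝ) = (ℓ ^ (11 / 10 : ℝ)) ^ 2 := by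
  rw [← Real.rpow_natCast, ← Real.rpow_mul hℓ]; norm_num

/-- `T = e^{𝓛^{1.1}} < e^{τ₁Λ} = T²` with `τ₁ = 2𝓛^{1.1}/Λ`, `Λ > 0`, `𝓛 ≥ 1`. [cite: Zhang2022LandauSiegel, §6 p.12] -/
theorem bigT_lt_exp_tau1 {D : ℕ} (hℓ : 1 ≤ Real.log D) :
    bigT D < Real.exp (2 * Real.log D ^ (11 / 10 : ℝ) / Real.log D ^ 9 * Real.log D ^ 9) := by
  have h9 : 0 < Real.log D ^ 9 := by positivity
  have hL1 : 0 < Real.log D ^ (11 / 10 : ℝ) := Real.rpow_pos_of_pos (by linarith) _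
  rw [bigT, Real.exp_lt_exp, div_mul_cancel₀ _ h9.ne', ell]
  linarith

/-! ### The ψ-side row, uniform in `t` -/

/-- **ψ-SIDE MAIN-TERM BOUND, uniform in the outer index.** Under the hypotheses of `psiRow_C2` (real character `χ` mod `D`,
`𝓛 ≥ 3`, `‖L(1,χ)‖ ≤ 𝓛⁻²⁰²²`, a `C²` short piece on `[0,θ]`, `θ ≤ 1`, `1 ≤ t`, `𝓛^{1.1}/Λ ≤ Z_t = θ − z_t`,
`e^{θΛ} < ⌈PT⁻²⌉`) and `0 ≤ B₀, B₁, B₂`: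
`‖M_j(t) + χ(t)Λ⁻¹L′(1,χ)·jetEx(β_jΛ)(z_t)‖ ≤ Λ⁻¹·δM₀`,
`δM₀ = C₈₂(0)𝓛⁻⁶(J₀ + S) + (L₁/Λ)·S·(2L₁² + ‖L′‖)`, `J₀ = ‖γ‖B₀ + B₁`, `S = ‖γ‖²B₀ + 2‖γ‖B₁ + B₂`, `γ = β_jΛ`, `L₁ = 𝓛^{1.1}`.
[cite: Zhang2022LandauSiegel, §8 Lemma 8.2 and display after Lemma 8.4, p.47] -/
theorem psi_main_bound {D : ℕ} [NeZero D] (χ : DirichletCharacter ℂ D) (c' : ℝ) (j : ℕ) (hprim : χ.IsPrimitive)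
    (hL : 3 ≤ Real.log D) (hA : ‖χ.LFunction 1‖ ≤ 1 / Real.log D ^ 2022) {u u' u'' : ℝ → ℂ} {θ : ℝ}
    (hθ1 : θ ≤ 1) (hu : ContinuousOn u (Icc 0 θ)) (hu' : ContinuousOn u' (Icc 0 θ)) (hu'' : ContinuousOn u'' (Icc 0 θ))
    (hd : ∀ y ∈ Ioo 0 θ, HasDerivWithinAt u (u' y) (Ioi y) y)
    (hd' : ∀ y ∈ Ioo 0 θ, HasDerivWithinAt u' (u'' y) (Ioi y) y) (hvan : ∀ y : ℝ, θ ≤ y → u y = 0)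
    {B₀ B₁ B₂ : ℝ} (hB00 : 0 ≤ B₀) (hB10 : 0 ≤ B₁) (hB20 : 0 ≤ B₂)
    (hB0 : ∀ y ∈ Icc 0 θ, ‖u y‖ ≤ B₀) (hB1 : ∀ y ∈ Icc 0 θ, ‖u' y‖ ≤ B₁)
    (hB2 : ∀ y ∈ Icc 0 θ, ‖u'' y‖ ≤ B₂) {t : ℕ} (ht : 1 ≤ t)
    (htT : Real.log D ^ (11 / 10 : ℝ) / Real.log D ^ 9 ≤ θ - Real.log t / Real.log D ^ 9)
    (hθN : Real.exp (θ * Real.log D ^ 9) < Nsupp D) :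
    ‖psiSum c' D χ j u t
        + χ (t : ZMod D) * ((Real.log D ^ 9 : ℝ) : ℂ)⁻¹ * deriv χ.LFunction 1 *
            jetEx (betaJ c' D j * Real.log D ^ 9) u u' (Real.log t / Real.log D ^ 9)‖
      ≤ (Real.log D ^ 9)⁻¹ * deltaM0 c' D j B₀ B₁ B₂ ‖deriv χ.LFunction 1‖ := by
  unfold deltaM0
  have key := psiRow_C2 χ c' j hprim hL hA hθ1 hu hu' hu'' hd hd' hvan hB0 hB1 hB2 ht htT hθN
  have hpsi : psiSum c' D χ j u t
      = ∑ m ∈ Finset.Ico 1 (Nsupp D), profTable u D χ (t * m) / (m : ℂ) ^ (1 - betaJ c' D j) := rfl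
  have hjet : χ (t : ZMod D) * ((Real.log D ^ 9 : ℝ) : ℂ)⁻¹ * deriv χ.LFunction 1 *
        jetEx (betaJ c' D j * Real.log D ^ 9) u u' (Real.log t / Real.log D ^ 9)
      = χ (t : ZMod D) * (((Real.log D ^ 9 : ℝ) : ℂ)⁻¹ * deriv χ.LFunction 1 *
          (betaJ c' D j * Real.log D ^ 9 * u (Real.log t / Real.log D ^ 9) + u' (Real.log t / Real.log D ^ 9))) := by
    unfold jetEx; ring
  rw [hpsi, hjet]
  refine key.trans ?_
  -- uniformise: `Z_t ≤ θ ≤ 1`, `𝓛^{2.2} = L₁²`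
  set γn : ℝ := ‖betaJ c' D j * Real.log D ^ 9‖ with hγn
  set S : ℝ := γn ^ 2 * B₀ + 2 * γn * B₁ + B₂ with hS
  have hℓ0 : 0 < Real.log D := by linarith
  have hZle : θ - Real.log t / Real.log D ^ 9 ≤ 1 := by
    have : 0 ≤ Real.log t / Real.log D ^ 9 := div_nonneg (Real.log_nonneg (by exact_mod_cast ht)) (by positivity)
    linarith
  have hS0 : 0 ≤ S := by positivity
  have hC0 : 0 ≤ Lemma82.C82 0 / Real.log D ^ 6 := by
    unfold Lemma82.C82
    have : 0 ≤ Lemma82.I0 := Lemma82.I0_nonneg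
    positivity
  have h22 : Real.log D ^ (22 / 10 : ℝ) = (Real.log D ^ (11 / 10 : ℝ)) ^ 2 := rpow_22_eq_sq hℓ0.le
  rw [h22]
  have hℓ9 : 0 ≤ (Real.log D ^ 9)⁻¹ := by positivity
  refine mul_le_mul_of_nonneg_left ?_ hℓ9
  refine add_le_add (mul_le_mul_of_nonneg_left ?_ hC0) le_rfl
  have : S * (θ - Real.log t / Real.log D ^ 9) ≤ S := by nlinarith
  linarith

/-- **Size of the ψ-side main term:** `‖χ(t)Λ⁻¹L′·jetEx(β_jΛ)(z)‖ ≤ Λ⁻¹·‖L′‖·(‖β_jΛ‖B₀ + B₁)` for `z ∈ [0,θ]`.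
[cite: Zhang2022LandauSiegel, §8 Lemma 8.2] -/
theorem norm_psiMain_le {D : ℕ} [NeZero D] (χ : DirichletCharacter ℂ D) (c' : ℝ) (j : ℕ) {u u' : ℝ → ℂ}
    {θ z B₀ B₁ : ℝ} (hB0 : ∀ y ∈ Icc 0 θ, ‖u y‖ ≤ B₀) (hB1 : ∀ y ∈ Icc 0 θ, ‖u' y‖ ≤ B₁) (hz : z ∈ Icc 0 θ)
    (hℓ : 0 < Real.log D) (t : ℕ) :
    ‖χ (t : ZMod D) * ((Real.log D ^ 9 : ℝ) : ℂ)⁻¹ * deriv χ.LFunction 1 * jetEx (betaJ c' D j * Real.log D ^ 9) u u' z‖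
      ≤ (Real.log D ^ 9)⁻¹ * (‖deriv χ.LFunction 1‖ * psiJ0 c' D j B₀ B₁) := by
  unfold psiJ0
  have h9 : 0 < Real.log D ^ 9 := by positivity
  rw [norm_mul, norm_mul, norm_mul, norm_inv, Complex.norm_real, Real.norm_of_nonneg h9.le]
  have hχ : ‖χ (t : ZMod D)‖ ≤ 1 := χ.norm_le_one _
  have hJ := norm_jetEx_le (γ := betaJ c' D j * Real.log D ^ 9) (hB0 z hz) (hB1 z hz)
  calc ‖χ (t : ZMod D)‖ * (Real.log D ^ 9)⁻¹ * ‖deriv χ.LFunction 1‖ * ‖jetEx (betaJ c' D j * Real.log D ^ 9) u u' z‖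
      ≤ 1 * (Real.log D ^ 9)⁻¹ * ‖deriv χ.LFunction 1‖ * (‖betaJ c' D j * Real.log D ^ 9‖ * B₀ + B₁) := by
        gcongr
    _ = _ := by ring

/-! ### The anti-side row, uniform in `(d,r)` up to the relative factor -/

/-- `β₆ ≠ 0` (`β₆ = 3iα/2`, `α > 0` for `𝓛 > 0`). [cite: Zhang2022LandauSiegel, §2 (2.22)] -/
theorem betaMu_six_ne_zero {D : ℕ} (hℓ : 0 < Real.log D) : betaMu D 6 ≠ 0 := by
  have hα : 0 < alpha D := by
    rw [alpha, bigP, Real.log_exp]; exact div_pos Real.pi_pos (by rw [ell]; positivity)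
  unfold betaMu beta6
  simp only [show (6 : ℕ) ≠ 7 by decide, if_false]
  intro h
  have : (3 * I * (alpha D : ℂ) / 2).im = 0 := by rw [h]; simp
  simp [Complex.mul_im] at this
  linarith

/-- `Re(β₆Λ) = 0`. [cite: Zhang2022LandauSiegel, §2 (2.22)] -/
theorem betaMu_mul_re (D : ℕ) (μ : ℕ) (Λ : ℝ) : (betaMu D μ * (Λ : ℂ)).re = 0 := by
  rw [Complex.mul_re, Section8PerronSteps.betaMu_re, Complex.ofReal_im]; ring

/-- **ANTI-SIDE MAIN-TERM BOUND, uniform in `(d,r)` up to `R(d,r) = (∏_{q∣dr}(1−q⁻¹)⁻¹)²(1 + |Π(d,r)|)`.** Data: a real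
character `χ` mod `D` with `𝓛 ≥ 3`; a `C²` short piece on `[0,θ]` (`θ < 1`), bounds `0 ≤ B₀,B₁,B₂`; the outer index
`t = dr ≥ 1` with `τ₁ = 2L₁/Λ ≤ Z_t` and `e^{θΛ} < ⌈PT⁻²⌉`; the fixed-modulus content of Lemma 8.4 (relative form) at
`(j, μ = 6, d, r)` with constant `C₈₄` (hypothesis `h84`), and a bound `Ξ` for the absolute logarithmic means of `ξ₀ⱼ(·;d,r)`
up to `e^{τ₁Λ} = T²` (hypothesis `hΞ`). Then, with `A₆ = β′β″/β₆²`, `C₆ = −(β′−β₆)(β″−β₆)Λ/β₆`, `γ₆ = β₆Λ`,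
`S = B₂ + 2‖γ₆‖B₁ + ‖γ₆‖²B₀`:
`‖N_j(d,r) − χ(t)Λ⁻¹L′Π(d,r)·massEx(σ_j,ν_j)(z_t)‖ ≤ Λ⁻¹·R(d,r)·δN₀`,
`δN₀ = C₈₄𝓛⁻⁶(B₁ + S) + τ₁S(τ₁ΛΞ + ‖L′‖(‖A₆‖ + ‖1−A₆‖ + ‖C₆‖τ₁))`.
[cite: Zhang2022LandauSiegel, §8 Lemmas 8.3–8.4 and display after Lemma 8.4, p.47] -/
theorem anti_main_bound {D : ℕ} [NeZero D] (χ : DirichletCharacter ℂ D) (hq : χ.IsQuadratic) (c' : ℝ) (j d r : ℕ)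
    (hL : 3 ≤ Real.log D) {u u' u'' : ℝ → ℂ} {θ : ℝ} (hθ1 : θ < 1)
    (hu : ContinuousOn u (Icc 0 θ)) (hu' : ContinuousOn u' (Icc 0 θ)) (hu'' : ContinuousOn u'' (Icc 0 θ))
    (hd : ∀ y ∈ Ioo 0 θ, HasDerivWithinAt u (u' y) (Ioi y) y)
    (hd' : ∀ y ∈ Ioo 0 θ, HasDerivWithinAt u' (u'' y) (Ioi y) y) (hvan : ∀ y : ℝ, θ ≤ y → u y = 0)
    {B₀ B₁ B₂ : ℝ} (hB00 : 0 ≤ B₀) (hB10 : 0 ≤ B₁) (hB20 : 0 ≤ B₂)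
    (hB0 : ∀ y ∈ Icc 0 θ, ‖u y‖ ≤ B₀) (hB1 : ∀ y ∈ Icc 0 θ, ‖u' y‖ ≤ B₁)
    (hB2 : ∀ y ∈ Icc 0 θ, ‖u'' y‖ ≤ B₂) (ht : 1 ≤ d * r)
    (htT : 2 * Real.log D ^ (11 / 10 : ℝ) / Real.log D ^ 9 ≤ θ - Real.log ((d * r : ℕ) : ℝ) / Real.log D ^ 9)
    (hθN : Real.exp (θ * Real.log D ^ 9) < Nsupp D)
    {C₈₄ Ξ : ℝ}
    (h84 : ∀ y : ℝ, bigT D < y → y < bigP D →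
      ‖(∑ n ∈ Finset.Ico 1 ⌈y⌉₊, χ (n : ZMod D) * xiZero c' D j n d r / (n : ℂ) *
            ((y / n : ℝ) : ℂ) ^ (-betaMu D 6) * (Real.log (y / n) : ℂ)) -
          deriv χ.LFunction 1 * PiW χ d r * frakgW c' D j 6 y‖
        ≤ C₈₄ * (Real.log D ^ 6)⁻¹ * (∏ q ∈ (d * r).primeFactors, (1 - (q : ℝ)⁻¹)⁻¹) ^ 2)
    (hΞ : ∀ y : ℝ, 1 ≤ y → y ≤ Real.exp (2 * Real.log D ^ (11 / 10 : ℝ) / Real.log D ^ 9 * Real.log D ^ 9) →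
      ∑ n ∈ Finset.Ico 1 ⌈y⌉₊, ‖xiZero c' D j n d r‖ / n ≤ Ξ) :
    ‖antiSum c' D χ j u d r
        - χ ((d * r : ℕ) : ZMod D) * ((Real.log D ^ 9 : ℝ) : ℂ)⁻¹ * deriv χ.LFunction 1 * PiW χ d r *
            massEx (sigmaJ c' D j) (nuJ c' D j) θ u u' (Real.log ((d * r : ℕ) : ℝ) / Real.log D ^ 9)‖
      ≤ (Real.log D ^ 9)⁻¹ *
        ((∏ q ∈ (d * r).primeFactors, (1 - (q : ℝ)⁻¹)⁻¹) ^ 2 * (1 + ‖PiW χ d r‖)) *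
        deltaN0 c' D j B₀ B₁ B₂ C₈₄ Ξ ‖deriv χ.LFunction 1‖ := by
  unfold deltaN0
  -- names
  set Λ : ℝ := Real.log D ^ 9 with hΛ
  set t : ℕ := d * r with htdef
  set z₀ : ℝ := Real.log (t : ℝ) / Λ with hz₀
  set Z : ℝ := θ - z₀ with hZ
  set τ₁ : ℝ := 2 * Real.log D ^ (11 / 10 : ℝ) / Λ with hτ₁
  set γ₆ : ℂ := betaMu D 6 * (Λ : ℂ) with hγ₆
  set A₆ : ℂ := betaJ c' D (j + 1) * betaJ c' D (j + 2) / betaMu D 6 ^ 2 with hA₆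
  set C₆ : ℂ := -((betaJ c' D (j + 1) - betaMu D 6) * (betaJ c' D (j + 2) - betaMu D 6)) * (Λ : ℝ) / betaMu D 6
    with hC₆
  set M₈₄ : ℂ := deriv χ.LFunction 1 * PiW χ d r with hM₈₄
  set rel : ℝ := (∏ q ∈ (d * r).primeFactors, (1 - (q : ℝ)⁻¹)⁻¹) ^ 2 with hrel
  set E₀ : ℝ := C₈₄ * (Real.log D ^ 6)⁻¹ * rel with hE₀
  have hℓ0 : 0 < Real.log D := by linarith
  have hℓ1 : 1 ≤ Real.log D := by linarith
  have hΛ0 : 0 < Λ := by positivity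
  have hL1pos : 0 < Real.log D ^ (11 / 10 : ℝ) := Real.rpow_pos_of_pos hℓ0 _
  have hτ0 : 0 < τ₁ := by positivity
  have ht0 : (0 : ℝ) < t := by exact_mod_cast ht
  have hz₀0 : 0 ≤ z₀ := div_nonneg (Real.log_nonneg (by exact_mod_cast ht)) hΛ0.le
  have hZτ : τ₁ ≤ Z := htT
  have hZθ : Z ≤ θ := by linarith
  have hZ1 : Z ≤ 1 := by linarith
  have hrel1 : 1 ≤ rel := Section8FrontEnd44ReductionRel.one_le_relFac (d * r)
  -- the two displayed inputs of `antiRow_C2` at `μ = 6`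
  have hTlt : bigT D < Real.exp (τ₁ * Λ) := by rw [hτ₁]; exact bigT_lt_exp_tau1 hℓ1
  have hZP : Real.exp (Z * Λ) < bigP D := by
    rw [bigP, Real.exp_lt_exp, ell]
    have : Z * Λ ≤ θ * Λ := mul_le_mul_of_nonneg_right hZθ hΛ0.le
    have hθΛ : θ * Λ < 1 * Λ := mul_lt_mul_of_pos_right hθ1 hΛ0
    linarith
  have hE : ∀ y ∈ Icc τ₁ Z, ‖xiRieszMean c' χ j 6 d r (Real.exp (y * Λ)) - M₈₄ * gProfile A₆ C₆ γ₆ y‖ ≤ E₀ := by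
    intro y hy
    have h := xiRieszMean_sub_le_of_lemma84 (c' := c') (χ := χ) (j := j) (μ := 6) (d := d) (r := r)
      (E₀ := E₀) (Λ := Λ) (τ := τ₁) (Z := Z) (T := bigT D) (P := bigP D) hΛ0 h84 hTlt hZP y hy
    rw [hM₈₄]
    exact h
  have hγre : γ₆.re = 0 := betaMu_mul_re D 6 Λ
  have hBlow : ∀ y ∈ Icc (0 : ℝ) τ₁, ‖xiRieszMean c' χ j 6 d r (Real.exp (y * Λ)) - M₈₄ * gProfile A₆ C₆ γ₆ y‖
      ≤ τ₁ * Λ * Ξ + ‖M₈₄‖ * (‖A₆‖ + ‖1 - A₆‖ + ‖C₆‖ * τ₁) :=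
    xiRieszMean_low_le (c' := c') (χ := χ) (j := j) (μ := 6) (d := d) (r := r) (M := M₈₄) (A := A₆) (C := C₆)
      (γ := γ₆) hΛ0 hγre hΞ
  -- apply the row
  have hγeq : betaMu D 6 * Real.log D ^ 9 = γ₆ := by rw [hγ₆, hΛ]; push_cast; ring
  have row := antiRow_C2 χ hq c' j 6 d r hℓ0 hτ0 hu hu' hu'' hd hd' hvan hB0 hB1 hB2 ht htT hθN hγeq hE hBlow
  -- identify the main term with `massEx σ ν`
  have hβ6 : betaMu D 6 ≠ 0 := betaMu_six_ne_zero hℓ0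
  obtain ⟨hσ, hν⟩ := massRule_constants (betaJ c' D (j + 1)) (betaJ c' D (j + 2)) (betaMu D 6) (Λ : ℂ) hβ6
  have hint : (∫ y in (0:ℝ)..(θ - Real.log (t : ℝ) / Real.log D ^ 9), conj (u (Real.log (t : ℝ) / Real.log D ^ 9 + y)))
      = ∫ y in z₀..θ, conj (u y) := by
    rw [← hΛ, ← hz₀]
    have h := intervalIntegral.integral_comp_add_left (fun y => conj (u y)) z₀ (a := 0) (b := θ - z₀)
    simp only [add_zero] at h
    rw [show z₀ + (θ - z₀) = θ by ring] at h
    exact h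
  have hmain : χ (t : ZMod D) * ((Real.log D ^ 9 : ℝ) : ℂ)⁻¹ * M₈₄ *
        (-conj (u' (Real.log (t : ℝ) / Real.log D ^ 9)) + (C₆ + γ₆ + γ₆ * A₆) * conj (u (Real.log (t : ℝ) / Real.log D ^ 9))
          + γ₆ ^ 2 * A₆ * ∫ y in (0:ℝ)..(θ - Real.log (t : ℝ) / Real.log D ^ 9),
              conj (u (Real.log (t : ℝ) / Real.log D ^ 9 + y)))
      = χ (t : ZMod D) * ((Real.log D ^ 9 : ℝ) : ℂ)⁻¹ * deriv χ.LFunction 1 * PiW χ d r *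
          massEx (sigmaJ c' D j) (nuJ c' D j) θ u u' z₀ := by
    rw [hint]
    have hC : C₆ + γ₆ + γ₆ * A₆ = sigmaJ c' D j := by
      rw [hC₆, hγ₆, hA₆, sigmaJ, ← hΛ, hσ]; ring
    have hN : γ₆ ^ 2 * A₆ = nuJ c' D j := by
      rw [hγ₆, hA₆, nuJ, ← hΛ, hν]; ring
    rw [hC, hN, hM₈₄, ← hΛ, ← hz₀]
    unfold massEx
    ring
  have hanti : antiSum c' D χ j u d r
      = ∑ n ∈ Finset.Ico 1 (Nsupp D), conj (profTable u D χ (t * n)) * xiZero c' D j n d r / (n : ℂ) := rfl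
  have hcast : ((d * r : ℕ) : ZMod D) = (t : ZMod D) := by rw [htdef]
  rw [hcast, hanti, ← hmain]
  refine row.trans ?_
  -- uniformise the right-hand side
  set γn : ℝ := ‖γ₆‖ with hγn
  set S : ℝ := B₂ + 2 * γn * B₁ + γn ^ 2 * B₀ with hS
  have hS0 : 0 ≤ S := by positivity
  have hPi0 : 0 ≤ ‖PiW χ d r‖ := norm_nonneg _
  have hrel0 : 0 < rel := lt_of_lt_of_le one_pos hrel1
  have hE00 : 0 ≤ E₀ := (norm_nonneg _).trans (hE τ₁ ⟨le_rfl, hZτ⟩)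
  have hC84 : 0 ≤ C₈₄ := by
    have h6 : 0 < (Real.log D ^ 6)⁻¹ * rel := mul_pos (by positivity) hrel0
    have : C₈₄ = E₀ / ((Real.log D ^ 6)⁻¹ * rel) := by
      rw [hE₀, mul_assoc, mul_div_cancel_right₀ _ h6.ne']
    rw [this]; exact div_nonneg hE00 h6.le
  have hM84 : ‖M₈₄‖ = ‖deriv χ.LFunction 1‖ * ‖PiW χ d r‖ := by rw [hM₈₄, norm_mul]
  have hγn' : ‖betaMu D 6 * Real.log D ^ 9‖ = γn := by
    rw [hγn, hγ₆, hΛ]; push_cast; ring_nf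
  rw [hγn']
  have hΞ0 : 0 ≤ Ξ := le_trans (Finset.sum_nonneg fun n _ => by positivity)
    (hΞ 1 le_rfl (Real.one_le_exp (by positivity)))
  have hL'0 : 0 ≤ ‖deriv χ.LFunction 1‖ := norm_nonneg _
  have hAC0 : 0 ≤ ‖A₆‖ + ‖1 - A₆‖ + ‖C₆‖ * τ₁ := by positivity
  have h16 : 0 ≤ C₈₄ / Real.log D ^ 6 := div_nonneg hC84 (by positivity)
  -- the real-arithmetic uniformisation
  have hZ' : θ - Real.log (t : ℝ) / Real.log D ^ 9 = Z := rfl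
  rw [hZ', hM84]
  have hSZ : S * Z ≤ S := mul_le_of_le_one_right hS0 hZ1
  have h1 : E₀ * (B₁ + S * Z) ≤ rel * (1 + ‖PiW χ d r‖) * (C₈₄ / Real.log D ^ 6 * (B₁ + S)) := by
    have e1 : E₀ * (B₁ + S) = rel * 1 * (C₈₄ / Real.log D ^ 6 * (B₁ + S)) := by rw [hE₀]; ring
    calc E₀ * (B₁ + S * Z) ≤ E₀ * (B₁ + S) := by gcongr
      _ = rel * 1 * (C₈₄ / Real.log D ^ 6 * (B₁ + S)) := e1
      _ ≤ rel * (1 + ‖PiW χ d r‖) * (C₈₄ / Real.log D ^ 6 * (B₁ + S)) := by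
          have h17 : 0 ≤ C₈₄ / Real.log D ^ 6 * (B₁ + S) := mul_nonneg h16 (by positivity)
          have h18 : rel * 1 ≤ rel * (1 + ‖PiW χ d r‖) := mul_le_mul_of_nonneg_left (by linarith) hrel0.le
          exact mul_le_mul_of_nonneg_right h18 h17
  have hx : 0 ≤ τ₁ * Λ * Ξ := by positivity
  have hy : 0 ≤ ‖deriv χ.LFunction 1‖ * (‖A₆‖ + ‖1 - A₆‖ + ‖C₆‖ * τ₁) := mul_nonneg hL'0 hAC0
  have hin : τ₁ * Λ * Ξ + ‖deriv χ.LFunction 1‖ * ‖PiW χ d r‖ * (‖A₆‖ + ‖1 - A₆‖ + ‖C₆‖ * τ₁)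
      ≤ (1 + ‖PiW χ d r‖) * (τ₁ * Λ * Ξ + ‖deriv χ.LFunction 1‖ * (‖A₆‖ + ‖1 - A₆‖ + ‖C₆‖ * τ₁)) := by
    have e2 : (1 + ‖PiW χ d r‖) * (τ₁ * Λ * Ξ + ‖deriv χ.LFunction 1‖ * (‖A₆‖ + ‖1 - A₆‖ + ‖C₆‖ * τ₁))
        - (τ₁ * Λ * Ξ + ‖deriv χ.LFunction 1‖ * ‖PiW χ d r‖ * (‖A₆‖ + ‖1 - A₆‖ + ‖C₆‖ * τ₁))
        = ‖PiW χ d r‖ * (τ₁ * Λ * Ξ) + ‖deriv χ.LFunction 1‖ * (‖A₆‖ + ‖1 - A₆‖ + ‖C₆‖ * τ₁) := by ring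
    have e3 : 0 ≤ ‖PiW χ d r‖ * (τ₁ * Λ * Ξ) + ‖deriv χ.LFunction 1‖ * (‖A₆‖ + ‖1 - A₆‖ + ‖C₆‖ * τ₁) :=
      add_nonneg (mul_nonneg hPi0 hx) hy
    linarith
  have h2 : τ₁ * S * (τ₁ * Λ * Ξ + ‖deriv χ.LFunction 1‖ * ‖PiW χ d r‖ * (‖A₆‖ + ‖1 - A₆‖ + ‖C₆‖ * τ₁))
      ≤ rel * (1 + ‖PiW χ d r‖) *
        (τ₁ * S * (τ₁ * Λ * Ξ + ‖deriv χ.LFunction 1‖ * (‖A₆‖ + ‖1 - A₆‖ + ‖C₆‖ * τ₁))) := by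
    have hτS : 0 ≤ τ₁ * S := mul_nonneg hτ0.le hS0
    calc τ₁ * S * (τ₁ * Λ * Ξ + ‖deriv χ.LFunction 1‖ * ‖PiW χ d r‖ * (‖A₆‖ + ‖1 - A₆‖ + ‖C₆‖ * τ₁))
        ≤ τ₁ * S * ((1 + ‖PiW χ d r‖) *
            (τ₁ * Λ * Ξ + ‖deriv χ.LFunction 1‖ * (‖A₆‖ + ‖1 - A₆‖ + ‖C₆‖ * τ₁))) :=
          mul_le_mul_of_nonneg_left hin hτS
      _ = 1 * ((1 + ‖PiW χ d r‖) *
            (τ₁ * S * (τ₁ * Λ * Ξ + ‖deriv χ.LFunction 1‖ * (‖A₆‖ + ‖1 - A₆‖ + ‖C₆‖ * τ₁)))) := by ring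
      _ ≤ rel * ((1 + ‖PiW χ d r‖) *
            (τ₁ * S * (τ₁ * Λ * Ξ + ‖deriv χ.LFunction 1‖ * (‖A₆‖ + ‖1 - A₆‖ + ‖C₆‖ * τ₁)))) :=
          mul_le_mul_of_nonneg_right hrel1 (mul_nonneg (by positivity) (mul_nonneg hτS (add_nonneg hx hy)))
      _ = _ := by ring
  have hΛinv : 0 ≤ Λ⁻¹ := by positivity
  calc Λ⁻¹ * (E₀ * (B₁ + S * Z) +
          τ₁ * S * (τ₁ * Λ * Ξ + ‖deriv χ.LFunction 1‖ * ‖PiW χ d r‖ * (‖A₆‖ + ‖1 - A₆‖ + ‖C₆‖ * τ₁)))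
      ≤ Λ⁻¹ * (rel * (1 + ‖PiW χ d r‖) * (C₈₄ / Real.log D ^ 6 * (B₁ + S)) +
          rel * (1 + ‖PiW χ d r‖) *
            (τ₁ * S * (τ₁ * Λ * Ξ + ‖deriv χ.LFunction 1‖ * (‖A₆‖ + ‖1 - A₆‖ + ‖C₆‖ * τ₁)))) :=
        mul_le_mul_of_nonneg_left (add_le_add h1 h2) hΛinv
    _ = _ := by ring

/-- **Size of the anti-side main term:** `‖χ(t)Λ⁻¹L′Π(d,r)·massEx(σ,ν)(z)‖ ≤ Λ⁻¹‖L′‖‖Π(d,r)‖(B₁ + ‖σ‖B₀ + ‖ν‖B₀θ)`,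
`z ∈ [0,θ]`. [cite: Zhang2022LandauSiegel, §8 Lemma 8.4] -/
theorem norm_antiMain_le {D : ℕ} [NeZero D] (χ : DirichletCharacter ℂ D) (d r : ℕ) {σ ν : ℂ} {u u' : ℝ → ℂ}
    {θ z B₀ B₁ : ℝ} (hB0 : ∀ y ∈ Icc 0 θ, ‖u y‖ ≤ B₀)
    (hB1 : ∀ y ∈ Icc 0 θ, ‖u' y‖ ≤ B₁) (hz : z ∈ Icc 0 θ) (hℓ : 0 < Real.log D) (t : ℕ) :
    ‖χ (t : ZMod D) * ((Real.log D ^ 9 : ℝ) : ℂ)⁻¹ * deriv χ.LFunction 1 * PiW χ d r * massEx σ ν θ u u' z‖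
      ≤ (Real.log D ^ 9)⁻¹ * (‖deriv χ.LFunction 1‖ * ‖PiW χ d r‖ * (B₁ + ‖σ‖ * B₀ + ‖ν‖ * (B₀ * θ))) := by
  have h9 : 0 < Real.log D ^ 9 := by positivity
  rw [norm_mul, norm_mul, norm_mul, norm_mul, norm_inv, Complex.norm_real, Real.norm_of_nonneg h9.le]
  have hχ : ‖χ (t : ZMod D)‖ ≤ 1 := χ.norm_le_one _
  have hK := norm_massEx_le (σ := σ) (ν := ν) hB0 hB1 hz
  calc ‖χ (t : ZMod D)‖ * (Real.log D ^ 9)⁻¹ * ‖deriv χ.LFunction 1‖ * ‖PiW χ d r‖ * ‖massEx σ ν θ u u' z‖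
      ≤ 1 * (Real.log D ^ 9)⁻¹ * ‖deriv χ.LFunction 1‖ * ‖PiW χ d r‖ * (B₁ + ‖σ‖ * B₀ + ‖ν‖ * (B₀ * θ)) := by
        gcongr
    _ = _ := by ring

/-! ### The product -/

/-- **Algebra of the product step:** `‖M − A‖ ≤ Λ⁻¹δM`, `‖N − B‖ ≤ Λ⁻¹δN`, `‖A‖ ≤ Λ⁻¹a`, `‖B‖ ≤ Λ⁻¹b` give
`‖MN − AB‖ ≤ Λ⁻²(δM(b + δN) + aδN)` (`MN − AB = (M−A)N + A(N−B)`). [cite: Zhang2022LandauSiegel, §8 p.47] -/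
theorem norm_mul_sub_mul_le_of {M N A B : ℂ} {Λ δM δN a b : ℝ} (hΛ : 0 < Λ) (hM : ‖M - A‖ ≤ Λ⁻¹ * δM)
    (hN : ‖N - B‖ ≤ Λ⁻¹ * δN) (hA : ‖A‖ ≤ Λ⁻¹ * a) (hB : ‖B‖ ≤ Λ⁻¹ * b) :
    ‖M * N - A * B‖ ≤ (Λ ^ 2)⁻¹ * (δM * (b + δN) + a * δN) := by
  have hΛi : 0 ≤ Λ⁻¹ := inv_nonneg.mpr hΛ.le
  have hδM : 0 ≤ Λ⁻¹ * δM := (norm_nonneg _).trans hM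
  have hδN : 0 ≤ Λ⁻¹ * δN := (norm_nonneg _).trans hN
  have ha : 0 ≤ Λ⁻¹ * a := (norm_nonneg _).trans hA
  have hNle : ‖N‖ ≤ Λ⁻¹ * b + Λ⁻¹ * δN := by
    calc ‖N‖ = ‖B + (N - B)‖ := by rw [add_sub_cancel]
      _ ≤ ‖B‖ + ‖N - B‖ := norm_add_le _ _
      _ ≤ Λ⁻¹ * b + Λ⁻¹ * δN := add_le_add hB hN
  have e : M * N - A * B = (M - A) * N + A * (N - B) := by ring
  rw [e]
  calc ‖(M - A) * N + A * (N - B)‖ ≤ ‖(M - A) * N‖ + ‖A * (N - B)‖ := norm_add_le _ _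
    _ = ‖M - A‖ * ‖N‖ + ‖A‖ * ‖N - B‖ := by rw [norm_mul, norm_mul]
    _ ≤ (Λ⁻¹ * δM) * (Λ⁻¹ * b + Λ⁻¹ * δN) + (Λ⁻¹ * a) * (Λ⁻¹ * δN) := by
        gcongr
    _ = (Λ ^ 2)⁻¹ * (δM * (b + δN) + a * δN) := by
        have : (Λ ^ 2)⁻¹ = Λ⁻¹ * Λ⁻¹ := by rw [pow_two, mul_inv]
        rw [this]; ring

/-- **THE POINTWISE STEP (packaged):** from the uniform ψ-bound `‖M − A‖ ≤ Λ⁻¹δM₀`, the relative anti-bound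
`‖N − B‖ ≤ Λ⁻¹RδN₀` (`R ≥ 1`), and the sizes `‖A‖ ≤ Λ⁻¹‖L′‖J₀`, `‖B‖ ≤ Λ⁻¹‖L′‖‖Π‖K₀` (`‖Π‖ ≤ R`):
`‖MN − AB‖ ≤ Λ⁻²·R·(δM₀(‖L′‖K₀ + δN₀) + ‖L′‖J₀δN₀)`. [cite: Zhang2022LandauSiegel, §8 p.47] -/
theorem pointwise_good {M N A B : ℂ} {Λ δM δN L J K Pn R : ℝ} (hΛ : 0 < Λ) (hPR : Pn ≤ R)
    (hδM0 : 0 ≤ δM) (hL0 : 0 ≤ L) (hK0 : 0 ≤ K)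
    (hM : ‖M - A‖ ≤ Λ⁻¹ * δM) (hN : ‖N - B‖ ≤ Λ⁻¹ * (R * δN)) (hA : ‖A‖ ≤ Λ⁻¹ * (L * J))
    (hB : ‖B‖ ≤ Λ⁻¹ * (L * Pn * K)) :
    ‖M * N - A * B‖ ≤ (Λ ^ 2)⁻¹ * R * (δM * (L * K + δN) + L * J * δN) := by
  have h := norm_mul_sub_mul_le_of hΛ hM hN hA hB
  refine h.trans ?_
  have hΛ2 : 0 ≤ (Λ ^ 2)⁻¹ := by positivity
  rw [mul_assoc ((Λ ^ 2)⁻¹)]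
  refine mul_le_mul_of_nonneg_left ?_ hΛ2
  have e : R * (δM * (L * K + δN) + L * J * δN) - (δM * (L * Pn * K + R * δN) + L * J * (R * δN))
      = δM * (L * K) * (R - Pn) := by ring
  have h0 : 0 ≤ δM * (L * K) * (R - Pn) := mul_nonneg (mul_nonneg hδM0 (mul_nonneg hL0 hK0)) (sub_nonneg.mpr hPR)
  linarith

end Literature.NumberTheory.LFunctions.Zhang2022.DipoleRule

end
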